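import Summits.CriticalPhenomena.PercolationContinuityZ3.Theses.PercNearOneGluing
import Summits.CriticalPhenomena.PercolationContinuityZ3.Theorems.PercNearOneGluingAdditiveGluingEdgeAffine
import Summits.CriticalPhenomena.PercolationContinuityZ3.Theorems.PercNearOneGluingAdditiveGluingGlueReach
import Literature.Probability.Percolation.PercolationProofs
import HarnessLib

/-!
# Crux `PercNearOneGluing.AdditiveGluing` (stmt-CriticalPhenomena-4576), line `replica-splice-at-entrance` —
# stub `stub_tieLiftOne`: the tie reduction, first half (one lifted pair)

Helper file for the crux (lead prover-line-stmt-CriticalPhenomena-4576-c3): proves exactly the registered stub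
signature `stub_tieLiftOne`; lands with `--supports stmt-CriticalPhenomena-4576`; it does NOT close the crux.

## Statement

If the additive gluing inequality `P(o ↔ A) − t ≤ P(o ↔ b)` (`0 ≤ t`, `P(a ↔ b) ≥ 1 − t` on `A`) holds on every
finite weighted graph whenever TWO distinct relays `a₀ ≠ a₁` attain the slack exactly
(`P(a₀ ↔ b) = P(a₁ ↔ b) = 1 − t`), then it holds always (`…Theses.PercNearOneGluing.AdditiveGluing`).

## Proof (Kozma–Nitzan, arXiv:2401.12397, §5.3 "move the weight of one edge"; the lead's paper proof)

WLOG `A ≠ ∅` and `t = t₀ := 1 − P(a₀ ↔ b)` for a minimiser `a₀` of `a ↦ P(a ↔ b)` on `A` (the conclusion is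
monotone in `t`).  If a second relay attains `t₀`, the hypothesis applies.  If `a₀ = b` or `A = {a₀}` the claim
is the union bound `P(o ↔ A) ≤ P(o ↔ b) + Σ_a P(a ↮ b)` (`tieLiftOne_unionBound`).  Otherwise raise the weight `p`
of the pair `e = s(a₀, b)` from `p₀ = w e` towards `1`:

* every `P_{w[e↦p]}(S)` is affine in `p` (`real_update_affine`, from the landed one-bond decomposition), with
  endpoint measures `P₀ = P_{w[e↦0]}`, `P₁ = P_{w[e↦1]}`; and `P₁(S) = P₀(insert e ⁻¹' S)`
  (`goodStepEI_prodBernoulli_map_insert`);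
* `g(p) := F_{a₀}(p) − max_{a ≠ a₀} F_a(p)` with `F_a(p) := 1 − P_{w[e↦p]}(a ↔ b)` is continuous, `> 0` at `p₀`
  (unique minimiser) and `≤ 0` at `1` (`P₁(a₀ ↔ b) = 1`), so by the intermediate value theorem it vanishes at
  some `p* ∈ [p₀, 1]`, where two relays attain `t* := F_{a₀}(p*)` and the hypothesis gives `Ψ(p*) ≤ 0` for the
  affine `Ψ(p) := P_p(o ↔ A) − P_p(o ↔ b) − F_{a₀}(p)`;
* the slope of `Ψ` is `[P₁ − P₀](o ↔ A) − [P₁ − P₀](o ↔ b) + [P₁ − P₀](a₀ ↔ b) ≥ 0`, because `o ↔ A` is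
  increasing (`P₀ ≤ P₁`), `P₁(a₀ ↔ b) = 1`, and `P₁(o ↔ b) ≤ P₀(o ↔ b) + P₀(a₀ ↮ b)` (in `insert e ω`, `o ↔ b`
  forces `o ↔ b` or `o ↔ a₀` in `ω`: `glueReach_walk_split`); hence `Ψ(p₀) ≤ Ψ(p*) ≤ 0`, which is the claim.
-/

namespace Summit.CriticalPhenomena.PercolationContinuityZ3.Theorems

open MeasureTheory Set
open Literature.Probability.LatticeModels Literature.Probability.Percolation

noncomputable section

variable {n : ℕ}

/-! ### The pushforward `P₁ = P₀ ∘ (insert e)⁻¹` and its three consequences -/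

/-- `ω ↦ insert e ω` is measurable on bond configurations. [folklore] -/
theorem tieLiftOne_measurable_insert (e : Sym2 (Fin n)) :
    Measurable fun ω : BondConfig (Fin n) => insert e ω := by
  refine measurable_set_iff.2 fun i => ?_
  simp only [Set.mem_insert_iff]
  exact measurable_const.or (measurable_set_mem i)

/-- `P_{w[e↦1]}(S) = P_{w[e↦0]}((insert e)⁻¹' S)`: opening the pair `e` almost surely is the pushforward of
closing it almost surely under `ω ↦ insert e ω`. [folklore] -/
theorem tieLiftOne_real_one_eq (w : Sym2 (Fin n) → unitInterval) (e : Sym2 (Fin n))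
    (S : Set (BondConfig (Fin n))) :
    (prodBernoulli (Function.update w e 1)).real S =
      (prodBernoulli (Function.update w e 0)).real ((fun ω : BondConfig (Fin n) => insert e ω) ⁻¹' S) := by
  rw [← map_measureReal_apply (tieLiftOne_measurable_insert e) (Set.toFinite S).measurableSet,
    goodStepEI_prodBernoulli_map_insert, Function.update_idem]

/-- Monotonicity in one weight for increasing events: `P_{w[e↦0]}(S) ≤ P_{w[e↦1]}(S)`. [folklore] -/
theorem tieLiftOne_real_zero_le_one (w : Sym2 (Fin n) → unitInterval) (e : Sym2 (Fin n))
    {S : Set (BondConfig (Fin n))} (hS : IsUpperSet S) :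
    (prodBernoulli (Function.update w e 0)).real S ≤ (prodBernoulli (Function.update w e 1)).real S := by
  rw [tieLiftOne_real_one_eq]
  exact measureReal_mono (fun ω hω => hS (Set.subset_insert e ω) hω) (measure_ne_top _ _)

/-- With the pair `s(a, b)` (`a ≠ b`) open almost surely, `a ↔ b` almost surely:
`P_{w[s(a,b)↦1]}(a ↔ b) = 1`. [folklore] -/
theorem tieLiftOne_real_one_conn (w : Sym2 (Fin n) → unitInterval) {a b : Fin n} (hab : a ≠ b) :
    (prodBernoulli (Function.update w s(a, b) 1)).real (openConn a b) = 1 := by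
  rw [tieLiftOne_real_one_eq]
  have h : (fun ω : BondConfig (Fin n) => insert s(a, b) ω) ⁻¹' (openConn a b) = univ := by
    refine Set.eq_univ_of_forall fun ω => ?_
    show (openGraph (insert s(a, b) ω)).Reachable a b
    apply SimpleGraph.Adj.reachable
    rw [openGraph_adj]
    exact ⟨Set.mem_insert _ _, hab⟩
  rw [h, probReal_univ]

/-- Opening the pair `s(a, b)` helps `o ↔ b` by at most `P(a ↮ b)`:
`P_{w[s(a,b)↦1]}(o ↔ b) ≤ P_{w[s(a,b)↦0]}(o ↔ b) + P_{w[s(a,b)↦0]}(a ↮ b)`, since `o ↔ b` in `insert s(a,b) ω`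
forces `o ↔ b` or `o ↔ a` in `ω` (`glueReach_walk_split`). [folklore] -/
theorem tieLiftOne_real_one_conn_le (w : Sym2 (Fin n) → unitInterval) (a b o : Fin n) :
    (prodBernoulli (Function.update w s(a, b) 1)).real (openConn o b) ≤
      (prodBernoulli (Function.update w s(a, b) 0)).real (openConn o b) +
        (1 - (prodBernoulli (Function.update w s(a, b) 0)).real (openConn a b)) := by
  rw [tieLiftOne_real_one_eq, ← probReal_compl_eq_one_sub (Set.toFinite _).measurableSet]
  refine le_trans (measureReal_mono ?_ (measure_ne_top _ _)) (measureReal_union_le _ _)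
  intro ω hω
  have hω' : (openGraph (insert s(a, b) ω)).Reachable o b := hω
  by_cases hab : ω ∈ openConn a b
  · left
    have hab' : (openGraph ω).Reachable a b := hab
    have hHG : ∀ x y : Fin n, (openGraph (insert s(a, b) ω)).Adj x y →
        (openGraph ω).Adj x y ∨ (x ∈ ({a, b} : Finset (Fin n)) ∧ y ∈ ({a, b} : Finset (Fin n))) := by
      intro x y hxy
      rw [openGraph_adj, Set.mem_insert_iff] at hxy
      obtain ⟨h | h, hne⟩ := hxy
      · right
        rw [Sym2.eq, Sym2.rel_iff'] at h
        rcases h with ⟨rfl, rfl⟩ | ⟨rfl, rfl⟩ <;> simp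
      · exact Or.inl ((openGraph_adj ω x y).2 ⟨h, hne⟩)
    obtain ⟨wk⟩ := hω'
    rcases glueReach_walk_split hHG wk with h | ⟨⟨s, hs, hos⟩, -⟩
    · exact h
    · rw [Finset.mem_insert, Finset.mem_singleton] at hs
      rcases hs with rfl | rfl
      · exact hos.trans hab'
      · exact hos
  · exact Or.inr hab

/-- **Union bound**: `P(o ↔ A) ≤ P(o ↔ b) + Σ_{a ∈ A} P(a ↮ b)` (if `o ↔ a` and `a ↔ b` then `o ↔ b`). [folklore] -/
theorem tieLiftOne_unionBound (w : Sym2 (Fin n) → unitInterval) (A : Finset (Fin n)) (o b : Fin n) :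
    (prodBernoulli w).real (⋃ a ∈ A, openConn o a) ≤
      (prodBernoulli w).real (openConn o b) + ∑ a ∈ A, (1 - (prodBernoulli w).real (openConn a b)) := by
  have hsub : (⋃ a ∈ A, (openConn o a : Set (BondConfig (Fin n)))) ⊆
      openConn o b ∪ ⋃ a ∈ A, (openConn a b)ᶜ := by
    intro ω hω
    simp only [mem_iUnion, exists_prop] at hω
    obtain ⟨a, ha, hoa⟩ := hω
    by_cases hab : ω ∈ openConn a b
    · exact Or.inl (show (openGraph ω).Reachable o b from
        (show (openGraph ω).Reachable o a from hoa).trans hab)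
    · refine Or.inr ?_
      simp only [mem_iUnion, exists_prop]
      exact ⟨a, ha, hab⟩
  calc (prodBernoulli w).real (⋃ a ∈ A, openConn o a)
      ≤ (prodBernoulli w).real (openConn o b ∪ ⋃ a ∈ A, (openConn a b)ᶜ) :=
        measureReal_mono hsub (measure_ne_top _ _)
    _ ≤ (prodBernoulli w).real (openConn o b) + (prodBernoulli w).real (⋃ a ∈ A, (openConn a b)ᶜ) :=
        measureReal_union_le _ _
    _ ≤ (prodBernoulli w).real (openConn o b) + ∑ a ∈ A, (prodBernoulli w).real (openConn a b)ᶜ := by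
        gcongr
        exact measureReal_biUnion_finset_le _ _
    _ = (prodBernoulli w).real (openConn o b) + ∑ a ∈ A, (1 - (prodBernoulli w).real (openConn a b)) := by
        congr 1
        refine Finset.sum_congr rfl fun a _ => ?_
        exact probReal_compl_eq_one_sub (Set.toFinite _).measurableSet

/-! ### The lift along one pair -/

/-- **The one-pair lift** (core of `stub_tieLiftOne`): if the tied case of additive gluing holds, `a₀ ∈ A` is the
unique STRICT minimiser of `a ↦ P(a ↔ b)` on `A`, `a₀ ≠ b` and `A ≠ {a₀}`, then
`P(o ↔ A) − P(o ↔ b) ≤ P(a₀ ↮ b)`.  Raise the weight of `s(a₀, b)` until a second relay ties (intermediate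
value theorem on the affine failure probabilities), apply the hypothesis there, and come back along the affine
functional `Ψ`, whose slope is non-negative. [folklore] -/
theorem tieLiftOne_lift
    (hT : ∀ (n : ℕ) (w : Sym2 (Fin n) → unitInterval) (A : Finset (Fin n)) (o b : Fin n) (t : ℝ), 0 ≤ t →
        (∀ a ∈ A, 1 - t ≤ (prodBernoulli w).real (openConn a b)) →
        (∃ a₀ ∈ A, ∃ a₁ ∈ A, a₀ ≠ a₁ ∧ (prodBernoulli w).real (openConn a₀ b) = 1 - t ∧
          (prodBernoulli w).real (openConn a₁ b) = 1 - t) →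
        (prodBernoulli w).real (⋃ a ∈ A, openConn o a) - t ≤ (prodBernoulli w).real (openConn o b))
    (w : Sym2 (Fin n) → unitInterval) (A : Finset (Fin n)) (o b a₀ : Fin n)
    (ha₀ : a₀ ∈ A) (hab : a₀ ≠ b) (hne : (A.erase a₀).Nonempty)
    (hstrict : ∀ a ∈ A, a ≠ a₀ →
      (prodBernoulli w).real (openConn a₀ b) < (prodBernoulli w).real (openConn a b)) :
    (prodBernoulli w).real (⋃ a ∈ A, openConn o a) - (prodBernoulli w).real (openConn o b) ≤
      1 - (prodBernoulli w).real (openConn a₀ b) := by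
  -- the two endpoint measures and the affine interpolation `L S p = P₀ S + p (P₁ S − P₀ S)`
  set P0 : Set (BondConfig (Fin n)) → ℝ := (prodBernoulli (Function.update w s(a₀, b) 0)).real
  set P1 : Set (BondConfig (Fin n)) → ℝ := (prodBernoulli (Function.update w s(a₀, b) 1)).real with hP1
  obtain ⟨L, hL⟩ : ∃ L : Set (BondConfig (Fin n)) → ℝ → ℝ, L = fun S p => P0 S + p * (P1 S - P0 S) :=
    ⟨_, rfl⟩
  have hLp : ∀ (S : Set (BondConfig (Fin n))) (p : ℝ), p ∈ Icc (0:ℝ) 1 →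
      (prodBernoulli (Function.update w s(a₀, b) (projIcc (0:ℝ) 1 zero_le_one p))).real S = L S p := by
    intro S p hp
    rw [hL, real_update_affine w s(a₀, b) S hp]
  have hLw : ∀ S : Set (BondConfig (Fin n)), (prodBernoulli w).real S = L S (w s(a₀, b)) := by
    intro S
    have h := hLp S (w s(a₀, b)) ⟨(w s(a₀, b)).2.1, (w s(a₀, b)).2.2⟩
    rwa [projIcc_val zero_le_one (w s(a₀, b)), Function.update_eq_self] at h
  -- failure functions `F a p = 1 − L (a ↔ b) p` and the gap `g` to the runner-up
  obtain ⟨F, hF⟩ : ∃ F : Fin n → ℝ → ℝ, F = fun a p => 1 - L (openConn a b) p := ⟨_, rfl⟩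
  obtain ⟨g, hg⟩ : ∃ g : ℝ → ℝ, g = fun p => F a₀ p - (A.erase a₀).sup' hne (fun a => F a p) := ⟨_, rfl⟩
  have hFc : ∀ a, Continuous (F a) := fun a => by
    rw [hF, hL]
    fun_prop
  have hgc : Continuous g := by
    rw [hg]
    exact (hFc a₀).sub (Continuous.finset_sup'_apply hne fun a _ => hFc a)
  have hg0 : 0 < g (w s(a₀, b)) := by
    have h : (A.erase a₀).sup' hne (fun a => F a (w s(a₀, b))) < F a₀ (w s(a₀, b)) := by
      rw [Finset.sup'_lt_iff]
      intro a ha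
      obtain ⟨hne', haA⟩ := Finset.mem_erase.1 ha
      have h := hstrict a haA hne'
      rw [hLw, hLw (openConn a b)] at h
      rw [hF]
      linarith
    rw [hg]
    linarith
  have hg1 : g 1 ≤ 0 := by
    obtain ⟨a', ha'⟩ := id hne
    have h1 : F a₀ 1 = 0 := by
      have h := tieLiftOne_real_one_conn w hab
      rw [hF, hL]
      simp only [hP1] at h ⊢
      linarith
    have h2 : 0 ≤ F a' 1 := by
      have h : (prodBernoulli (Function.update w s(a₀, b) 1)).real (openConn a' b) ≤ 1 := measureReal_le_one
      rw [hF, hL]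
      simp only [hP1]
      linarith
    have h3 : F a' 1 ≤ (A.erase a₀).sup' hne (fun a => F a 1) := Finset.le_sup' (fun a => F a 1) ha'
    rw [hg]
    linarith
  -- intermediate value theorem: the gap closes at some `q ∈ [w e, 1]`
  obtain ⟨q, hqI, hgq⟩ : ∃ q ∈ Icc (w s(a₀, b) : ℝ) 1, g q = 0 :=
    intermediate_value_Icc' (w s(a₀, b)).2.2 hgc.continuousOn ⟨hg1, hg0.le⟩
  have hq01 : q ∈ Icc (0:ℝ) 1 := ⟨(w s(a₀, b)).2.1.trans hqI.1, hqI.2⟩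
  -- the tie at `q`
  obtain ⟨a₁, ha₁, ha₁eq⟩ := Finset.exists_mem_eq_sup' hne (fun a => F a q)
  obtain ⟨ha₁ne, ha₁A⟩ := Finset.mem_erase.1 ha₁
  have hgq' : F a₀ q - (A.erase a₀).sup' hne (fun a => F a q) = 0 := by rw [hg] at hgq; exact hgq
  have htie : F a₁ q = F a₀ q := by linarith
  have hall : ∀ a ∈ A, F a q ≤ F a₀ q := by
    intro a ha
    by_cases haa : a = a₀
    · rw [haa]
    · have h : F a q ≤ (A.erase a₀).sup' hne (fun a => F a q) :=
        Finset.le_sup' (fun a => F a q) (Finset.mem_erase.2 ⟨haa, ha⟩)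
      linarith
  -- the hypothesis at the tied weights `w[e ↦ q]` with slack `t* = F a₀ q`
  have hFq : ∀ a, (prodBernoulli (Function.update w s(a₀, b) (projIcc (0:ℝ) 1 zero_le_one q))).real
      (openConn a b) = 1 - F a q := by
    intro a
    rw [hLp _ _ hq01, hF]
    ring
  have happ := hT n (Function.update w s(a₀, b) (projIcc (0:ℝ) 1 zero_le_one q)) A o b (F a₀ q)
    (by linarith [hFq a₀, (measureReal_le_one :
      (prodBernoulli (Function.update w s(a₀, b) (projIcc (0:ℝ) 1 zero_le_one q))).real (openConn a₀ b) ≤ 1)])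
    (fun a ha => by rw [hFq a]; linarith [hall a ha])
    ⟨a₀, ha₀, a₁, ha₁A, fun h => ha₁ne h.symm, hFq a₀, by rw [hFq a₁, htie]⟩
  rw [hLp _ _ hq01, hLp _ _ hq01] at happ
  -- the slope of `Ψ` is non-negative
  have hF1 : P0 (⋃ a ∈ A, openConn o a) ≤ P1 (⋃ a ∈ A, openConn o a) :=
    tieLiftOne_real_zero_le_one w s(a₀, b) (isUpperSet_iUnion₂ fun a _ => isUpperSet_openConn o a)
  have hF2 : P1 (openConn a₀ b) = 1 := tieLiftOne_real_one_conn w hab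
  have hF3 : P1 (openConn o b) ≤ P0 (openConn o b) + (1 - P0 (openConn a₀ b)) :=
    tieLiftOne_real_one_conn_le w a₀ b o
  have hσ : 0 ≤ (P1 (⋃ a ∈ A, openConn o a) - P0 (⋃ a ∈ A, openConn o a)) -
      (P1 (openConn o b) - P0 (openConn o b)) + (P1 (openConn a₀ b) - P0 (openConn a₀ b)) := by
    linarith
  -- come back from `q` to `w e` along the affine `Ψ`
  rw [hLw (⋃ a ∈ A, openConn o a), hLw (openConn o b), hLw (openConn a₀ b)]
  rw [hF] at happ
  rw [hL] at happ ⊢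
  simp only at happ ⊢
  nlinarith [mul_nonneg (sub_nonneg.2 hqI.1) hσ]

/-! ### The registered stub -/

/-- Registered stub `stub_tieLiftOne` of crux stmt-CriticalPhenomena-4576 (line replica-splice-at-entrance):
**if additive gluing holds whenever two distinct relays attain the slack `t` exactly, it holds always.**
Cases: `A = ∅` (trivial); `t₀ := 1 − min_a P(a ↔ b) ≤ t` attained at `a₀` — a second minimiser: the hypothesis;
`a₀ = b` or `A = {a₀}`: the union bound `tieLiftOne_unionBound`; otherwise `tieLiftOne_lift`. [folklore] -/
theorem stub_tieLiftOne :
    (∀ (n : ℕ) (w : Sym2 (Fin n) → unitInterval) (A : Finset (Fin n)) (o b : Fin n) (t : ℝ), 0 ≤ t →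
        (∀ a ∈ A, 1 - t ≤ (prodBernoulli w).real (openConn a b)) →
        (∃ a₀ ∈ A, ∃ a₁ ∈ A, a₀ ≠ a₁ ∧ (prodBernoulli w).real (openConn a₀ b) = 1 - t ∧ (prodBernoulli w).real (openConn a₁ b) = 1 - t) →
        (prodBernoulli w).real (⋃ a ∈ A, openConn o a) - t ≤ (prodBernoulli w).real (openConn o b)) →
      Summit.CriticalPhenomena.PercolationContinuityZ3.Theses.PercNearOneGluing.AdditiveGluing := by
  intro hT n w A o b t ht hA
  -- `A = ∅`
  rcases A.eq_empty_or_nonempty with rfl | hAne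
  · have h0 : (prodBernoulli w).real (⋃ a ∈ (∅ : Finset (Fin n)), openConn o a) = 0 := by simp
    have hnn : 0 ≤ (prodBernoulli w).real (openConn o b) := measureReal_nonneg
    linarith
  -- the worst relay `a₀` and the reduction to `t₀ = P(a₀ ↮ b)`
  obtain ⟨a₀, ha₀, hmin⟩ :=
    Finset.exists_min_image A (fun a => (prodBernoulli w).real (openConn a b)) hAne
  have ht₀ : 1 - (prodBernoulli w).real (openConn a₀ b) ≤ t := by linarith [hA a₀ ha₀]
  suffices key : (prodBernoulli w).real (⋃ a ∈ A, openConn o a) - (prodBernoulli w).real (openConn o b) ≤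
      1 - (prodBernoulli w).real (openConn a₀ b) by linarith
  -- a second worst relay: the hypothesis applies with `t₀`
  by_cases htie : ∃ a₁ ∈ A, a₁ ≠ a₀ ∧
      (prodBernoulli w).real (openConn a₁ b) = (prodBernoulli w).real (openConn a₀ b)
  · obtain ⟨a₁, ha₁, hne, heq⟩ := htie
    have h := hT n w A o b (1 - (prodBernoulli w).real (openConn a₀ b)) (sub_nonneg.2 measureReal_le_one)
      (fun a ha => by linarith [hmin a ha]) ⟨a₀, ha₀, a₁, ha₁, fun h => hne h.symm, by ring, by rw [heq]; ring⟩
    linarith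
  push Not at htie
  have hstrict : ∀ a ∈ A, a ≠ a₀ →
      (prodBernoulli w).real (openConn a₀ b) < (prodBernoulli w).real (openConn a b) :=
    fun a ha hne => lt_of_le_of_ne (hmin a ha) (fun h => htie a ha hne h.symm)
  -- degenerate cases `a₀ = b` or `A = {a₀}`: the union bound
  have hub := tieLiftOne_unionBound w A o b
  by_cases hdeg : a₀ = b ∨ A.erase a₀ = ∅
  · have hsum : ∑ a ∈ A, (1 - (prodBernoulli w).real (openConn a b)) ≤
        1 - (prodBernoulli w).real (openConn a₀ b) := by
      rcases hdeg with rfl | h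
      · have h1 : (prodBernoulli w).real (openConn a₀ a₀) = 1 := by
          have huniv : (openConn a₀ a₀ : Set (BondConfig (Fin n))) = Set.univ :=
            Set.eq_univ_of_forall fun _ => SimpleGraph.Reachable.refl _
          rw [huniv, probReal_univ]
        have hzero : ∀ a ∈ A, 1 - (prodBernoulli w).real (openConn a a₀) ≤ 0 := by
          intro a ha
          have h := hmin a ha
          rw [h1] at h
          linarith
        calc ∑ a ∈ A, (1 - (prodBernoulli w).real (openConn a a₀)) ≤ ∑ a ∈ A, (0 : ℝ) :=
              Finset.sum_le_sum hzero
          _ ≤ 1 - (prodBernoulli w).real (openConn a₀ a₀) := by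
              rw [Finset.sum_const_zero]; exact sub_nonneg.2 measureReal_le_one
      · rw [Finset.erase_eq_empty_iff] at h
        rcases h with rfl | rfl
        · simp at ha₀
        · rw [Finset.sum_singleton]
    linarith
  push Not at hdeg
  exact tieLiftOne_lift hT w A o b a₀ ha₀ hdeg.1 hdeg.2 hstrict

end

end Summit.CriticalPhenomena.PercolationContinuityZ3.Theorems
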